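import Literature.NumberTheory.EllipticCurves.KenkuMinimalLevels
import HarnessLib

/-!
# Rational cyclic subgroups and `2`-power cyclic isogenies over `ℚ`: the consumed shapes of Mazur–Kenku

Literature / elliptic curves. A *proofs* file (theorems only, D-0014), companion of
`RationalIsogenyDegrees` (the named fact `mazurKenku_exists_cyclic_isogeny`: two `ℚ`-isogenous
elliptic curves over `ℚ` are joined by SOME cyclic `ℚ`-isogeny of degree in
`kenkuDegrees = {1, …, 19} ∪ {21, 25, 27, 37, 43, 67, 163}`) and of `KenkuMinimalLevels`, whose
`isCyclic_degree_mem_kenkuDegrees_of_mazurKenku` already derives from that `∃`-form the statement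
of Silverman, *AEC*, IX.6, Example 6.4 AS PRINTED — EVERY cyclic `ℚ`-isogeny between elliptic
curves over `ℚ` has degree in `kenkuDegrees` — through `End_ℚ(E) = ℤ` (the tree's theorem
`not_hasRationalCM_holds`) and a kernel count (`degree_eq_of_isCyclic`). So no further named fact is
needed to bound a GIVEN rational cyclic isogeny; this file records the shapes in which that bound
is consumed:

* `forall_isCyclic_degree_mem_kenkuDegrees_iff_mazurKenku` — the printed `∀`-form and the tree's
  `∃`-form are EQUIVALENT (bookkeeping: `mazurKenku_exists_cyclic_isogeny_of_forall_isCyclic` one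
  way, `isCyclic_degree_mem_kenkuDegrees_of_mazurKenku` the other);
* `mem_kenkuDegrees_of_dvd_isCyclic_degree_of_mazurKenku`, `isCyclic_degree_le_of_mazurKenku` —
  every divisor of the degree of a cyclic `ℚ`-isogeny is a Kenku degree; the degree is `≤ 163`;
* **the `2`-power part** ("no elliptic curve over `ℚ` has a rational cyclic `32`-isogeny":
  `16 ∈ kenkuDegrees`, `32 ∉`; `X₀(32)(ℚ)` consists of cusps, Kenku 1982):
  `not_dvd_isCyclic_degree_thirtyTwo_of_mazurKenku`, `isCyclic_degree_two_pow_le_four_of_mazurKenku`,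
  `le_four_of_two_pow_dvd_isCyclic_degree_of_mazurKenku`;
* **rational cyclic SUBGROUPS**: a finite `Γ_ℚ`-stable cyclic subgroup `S ≤ E(ℚ̄)` is the kernel of
  the quotient `ℚ`-isogeny `E → E/S` (*AEC* Prop. III.4.12, Rem. III.4.13.2 — the tree's THEOREM
  `exists_isogeny_ker_eq_and_comp_eq_nsmul_holds`), so `#S ∈ kenkuDegrees`
  (`natCard_mem_kenkuDegrees_of_stable_of_isAddCyclic_of_mazurKenku`), `#S ≤ 163`, and `#S = 2ᵏ`
  forces `k ≤ 4` (`le_four_of_natCard_eq_two_pow_of_stable_of_isAddCyclic_of_mazurKenku`) — the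
  form in which "the `Γ_ℚ`-stability depth of a cyclic line in `E[2^∞]` is at most `4`" is used to
  terminate a descent along rational cyclic `2`-power isogenies, with no isogeny to be built by the
  consumer.

## References

* J. H. Silverman, *The Arithmetic of Elliptic Curves*, 2nd ed., GTM 106, Springer 2009: IX.6
  Example 6.4; Prop. III.4.12, Remark III.4.13.2; Cor. III.4.11 [SilvermanAEC2009].
* B. Mazur, *Rational isogenies of prime degree*, Invent. Math. 44 (1978) 129–162, Thm. 1
  [Mazur1978]; M. A. Kenku, *On the number of `ℚ`-isomorphism classes of elliptic curves in each
  `ℚ`-isogeny class*, J. Number Theory 15 (1982) 199–202, Thm. 1 and the list of levels in its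
  proof [Kenku1982].

Design: theorems only — no definition, no named fact, no instance; every statement is relative to
the tree's named fact `mazurKenku_exists_cyclic_isogeny` (hypothesis `h`), exactly like
`isCyclic_degree_mem_kenkuDegrees_of_mazurKenku`.
-/

noncomputable section

open scoped Classical

namespace Literature.NumberTheory.EllipticCurves

open _root_.WeierstrassCurve

/-! ### The printed `∀`-form ⟺ the named `∃`-form -/

/-- **The printed `∀`-form and the tree's `∃`-form of Mazur–Kenku are equivalent**: "every cyclic
`ℚ`-isogeny between elliptic curves over `ℚ` has degree in `kenkuDegrees`" (Silverman, *AEC*,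
IX.6 Example 6.4 as printed) ⟺ `mazurKenku_exists_cyclic_isogeny` (`→`: the cyclic reduction
*AEC* Cor. III.4.11, `mazurKenku_exists_cyclic_isogeny_of_forall_isCyclic`; `←`: `End_ℚ(E) = ℤ`
and kernel counting, `isCyclic_degree_mem_kenkuDegrees_of_mazurKenku`).
[cite: SilvermanAEC2009, IX.6 Example 6.4 and Cor. III.4.11] -/
theorem forall_isCyclic_degree_mem_kenkuDegrees_iff_mazurKenku :
    (∀ (W W' : WeierstrassCurve ℚ) [W.IsElliptic] [W'.IsElliptic] (φ : Isogeny W W'),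
      φ.IsCyclic → φ.degree ∈ kenkuDegrees) ↔ mazurKenku_exists_cyclic_isogeny :=
  ⟨mazurKenku_exists_cyclic_isogeny_of_forall_isCyclic,
    fun h _ _ _ _ φ hφ ↦ isCyclic_degree_mem_kenkuDegrees_of_mazurKenku h φ hφ⟩

/-! ### Bounds on a given cyclic `ℚ`-isogeny -/

/-- **Every divisor of the degree of a cyclic `ℚ`-isogeny is a Kenku degree** (granted the fact):
`d ∣ deg φ → d ∈ kenkuDegrees` (Example 6.4 as printed, `isCyclic_degree_mem_kenkuDegrees_of_mazurKenku`,
and the list is closed under divisors, `mem_kenkuDegrees_of_dvd`); specific exclusions (`32`, `81`,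
`125`, `49`, `121`, …) are then `decide`. [cite: SilvermanAEC2009, IX.6 Example 6.4] -/
theorem mem_kenkuDegrees_of_dvd_isCyclic_degree_of_mazurKenku (h : mazurKenku_exists_cyclic_isogeny)
    {W W' : WeierstrassCurve ℚ} [W.IsElliptic] [W'.IsElliptic] (φ : Isogeny W W')
    (hφ : φ.IsCyclic) {d : ℕ} (hd : d ∣ φ.degree) : d ∈ kenkuDegrees :=
  mem_kenkuDegrees_of_dvd (isCyclic_degree_mem_kenkuDegrees_of_mazurKenku h φ hφ) hd

/-- **A cyclic `ℚ`-isogeny between elliptic curves over `ℚ` has degree at most `163`** (granted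
the fact). [cite: SilvermanAEC2009, IX.6 Example 6.4] -/
theorem isCyclic_degree_le_of_mazurKenku (h : mazurKenku_exists_cyclic_isogeny)
    {W W' : WeierstrassCurve ℚ} [W.IsElliptic] [W'.IsElliptic] (φ : Isogeny W W')
    (hφ : φ.IsCyclic) : φ.degree ≤ 163 :=
  le_of_mem_kenkuDegrees (isCyclic_degree_mem_kenkuDegrees_of_mazurKenku h φ hφ)

/-- **No rational cyclic `32`-isogeny**: granted the fact, `32 ∤ deg φ` for every cyclic
`ℚ`-isogeny `φ` between elliptic curves over `ℚ` (the `2`-power part of Example 6.4: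
`16 ∈ kenkuDegrees`, `32 ∉ kenkuDegrees`; `X₀(32)(ℚ)` consists of cusps, Kenku 1982).
[cite: SilvermanAEC2009, IX.6 Example 6.4] [cite: Kenku1982, Thm. 1 (proof, list of levels)] -/
theorem not_dvd_isCyclic_degree_thirtyTwo_of_mazurKenku (h : mazurKenku_exists_cyclic_isogeny)
    {W W' : WeierstrassCurve ℚ} [W.IsElliptic] [W'.IsElliptic] (φ : Isogeny W W')
    (hφ : φ.IsCyclic) : ¬ 32 ∣ φ.degree := fun h32 ↦
  absurd (mem_kenkuDegrees_of_dvd_isCyclic_degree_of_mazurKenku h φ hφ h32) (by decide)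

/-- **A cyclic `ℚ`-isogeny of `2`-power degree `2ᵏ` has `k ≤ 4`** (granted the fact): the rational
cyclic `2`-power isogenies have degree `1, 2, 4, 8` or `16`.
[cite: SilvermanAEC2009, IX.6 Example 6.4] [cite: Kenku1982, Thm. 1 (proof, list of levels)] -/
theorem isCyclic_degree_two_pow_le_four_of_mazurKenku (h : mazurKenku_exists_cyclic_isogeny)
    {W W' : WeierstrassCurve ℚ} [W.IsElliptic] [W'.IsElliptic] (φ : Isogeny W W')
    (hφ : φ.IsCyclic) {k : ℕ} (hk : φ.degree = 2 ^ k) : k ≤ 4 := by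
  by_contra hlt
  refine not_dvd_isCyclic_degree_thirtyTwo_of_mazurKenku h φ hφ ?_
  rw [hk, show (32 : ℕ) = 2 ^ 5 by norm_num]
  exact pow_dvd_pow 2 (by omega)

/-- **`2ᵏ ∣ deg φ` forces `k ≤ 4`** for a cyclic `ℚ`-isogeny `φ` between elliptic curves over `ℚ`
(granted the fact). [cite: SilvermanAEC2009, IX.6 Example 6.4] [cite: Kenku1982, Thm. 1 (proof, list of levels)] -/
theorem le_four_of_two_pow_dvd_isCyclic_degree_of_mazurKenku (h : mazurKenku_exists_cyclic_isogeny)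
    {W W' : WeierstrassCurve ℚ} [W.IsElliptic] [W'.IsElliptic] (φ : Isogeny W W')
    (hφ : φ.IsCyclic) {k : ℕ} (hk : 2 ^ k ∣ φ.degree) : k ≤ 4 := by
  by_contra hlt
  refine not_dvd_isCyclic_degree_thirtyTwo_of_mazurKenku h φ hφ (dvd_trans ?_ hk)
  rw [show (32 : ℕ) = 2 ^ 5 by norm_num]
  exact pow_dvd_pow 2 (by omega)

/-! ### Rational cyclic subgroups -/

/-- **A finite `Γ_ℚ`-stable CYCLIC subgroup of `E(ℚ̄)` has order in Kenku's list** (granted the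
fact): `S` is the kernel of the quotient `ℚ`-isogeny `g : E → E/S` onto an elliptic curve (*AEC*
Prop. III.4.12, Remark III.4.13.2; the tree's theorem `exists_isogeny_ker_eq_and_comp_eq_nsmul_holds`),
a cyclic `ℚ`-isogeny of degree `#S`, so Example 6.4 as printed
(`isCyclic_degree_mem_kenkuDegrees_of_mazurKenku`) applies to `g`.
[cite: SilvermanAEC2009, IX.6 Example 6.4 and Prop. III.4.12] -/
theorem natCard_mem_kenkuDegrees_of_stable_of_isAddCyclic_of_mazurKenku
    (h : mazurKenku_exists_cyclic_isogeny) (W : WeierstrassCurve ℚ) [W.IsElliptic]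
    (S : AddSubgroup W.geomPoints) (hfin : (S : Set W.geomPoints).Finite)
    (hstab : ∀ (σ : Field.absoluteGaloisGroup ℚ) (P : W.geomPoints), P ∈ S → σ • P ∈ S)
    (hcyc : IsAddCyclic S) : Nat.card S ∈ kenkuDegrees := by
  obtain ⟨W', hW', g, -, hker, -, -⟩ := W.exists_isogeny_ker_eq_and_comp_eq_nsmul_holds S hfin hstab
  haveI := hW'
  have hg : g.IsCyclic := by
    rw [Isogeny.IsCyclic, hker]
    exact hcyc
  have hdeg : g.degree = Nat.card S := by
    rw [Isogeny.degree, hker]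
  exact hdeg ▸ isCyclic_degree_mem_kenkuDegrees_of_mazurKenku h g hg

/-- **A finite `Γ_ℚ`-stable cyclic subgroup of `E(ℚ̄)` has order at most `163`** (granted the
fact). [cite: SilvermanAEC2009, IX.6 Example 6.4 and Prop. III.4.12] -/
theorem natCard_le_of_stable_of_isAddCyclic_of_mazurKenku
    (h : mazurKenku_exists_cyclic_isogeny) (W : WeierstrassCurve ℚ) [W.IsElliptic]
    (S : AddSubgroup W.geomPoints) (hfin : (S : Set W.geomPoints).Finite)
    (hstab : ∀ (σ : Field.absoluteGaloisGroup ℚ) (P : W.geomPoints), P ∈ S → σ • P ∈ S)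
    (hcyc : IsAddCyclic S) : Nat.card S ≤ 163 :=
  le_of_mem_kenkuDegrees
    (natCard_mem_kenkuDegrees_of_stable_of_isAddCyclic_of_mazurKenku h W S hfin hstab hcyc)

/-- **Every divisor of the order of a finite `Γ_ℚ`-stable cyclic subgroup of `E(ℚ̄)` is a Kenku
degree** (granted the fact; the list is closed under divisors).
[cite: SilvermanAEC2009, IX.6 Example 6.4 and Prop. III.4.12] -/
theorem mem_kenkuDegrees_of_dvd_natCard_of_stable_of_isAddCyclic_of_mazurKenku
    (h : mazurKenku_exists_cyclic_isogeny) (W : WeierstrassCurve ℚ) [W.IsElliptic]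
    (S : AddSubgroup W.geomPoints) (hfin : (S : Set W.geomPoints).Finite)
    (hstab : ∀ (σ : Field.absoluteGaloisGroup ℚ) (P : W.geomPoints), P ∈ S → σ • P ∈ S)
    (hcyc : IsAddCyclic S) {d : ℕ} (hd : d ∣ Nat.card S) : d ∈ kenkuDegrees :=
  mem_kenkuDegrees_of_dvd
    (natCard_mem_kenkuDegrees_of_stable_of_isAddCyclic_of_mazurKenku h W S hfin hstab hcyc) hd

/-- **A `Γ_ℚ`-stable cyclic subgroup of `E(ℚ̄)` of order `2ᵏ` has `k ≤ 4`** (granted the fact):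
the `Γ_ℚ`-stability depth of a cyclic `2`-power line in `E(ℚ̄)` is at most `4` — "no rational
cyclic `32`-isogeny". This is the termination input of a descent along rational cyclic `2`-power
isogenies (each further `Γ_ℚ`-stable layer `C[2ᵏ⁺¹]` of a cyclic line is a rational cyclic subgroup
of order `2ᵏ⁺¹`). [cite: SilvermanAEC2009, IX.6 Example 6.4 and Prop. III.4.12] [cite: Kenku1982, Thm. 1 (proof, list of levels)] -/
theorem le_four_of_natCard_eq_two_pow_of_stable_of_isAddCyclic_of_mazurKenku
    (h : mazurKenku_exists_cyclic_isogeny) (W : WeierstrassCurve ℚ) [W.IsElliptic]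
    (S : AddSubgroup W.geomPoints) (hfin : (S : Set W.geomPoints).Finite)
    (hstab : ∀ (σ : Field.absoluteGaloisGroup ℚ) (P : W.geomPoints), P ∈ S → σ • P ∈ S)
    (hcyc : IsAddCyclic S) {k : ℕ} (hk : Nat.card S = 2 ^ k) : k ≤ 4 := by
  by_contra hlt
  have h32 : 32 ∣ Nat.card S := by
    rw [hk, show (32 : ℕ) = 2 ^ 5 by norm_num]
    exact pow_dvd_pow 2 (by omega)
  exact absurd (mem_kenkuDegrees_of_dvd_natCard_of_stable_of_isAddCyclic_of_mazurKenku h W S hfin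
    hstab hcyc h32) (by decide)

/-- **`2ᵏ ∣ #S` forces `k ≤ 4`** for a finite `Γ_ℚ`-stable cyclic subgroup `S` of `E(ℚ̄)` (granted
the fact). [cite: SilvermanAEC2009, IX.6 Example 6.4 and Prop. III.4.12] [cite: Kenku1982, Thm. 1 (proof, list of levels)] -/
theorem le_four_of_two_pow_dvd_natCard_of_stable_of_isAddCyclic_of_mazurKenku
    (h : mazurKenku_exists_cyclic_isogeny) (W : WeierstrassCurve ℚ) [W.IsElliptic]
    (S : AddSubgroup W.geomPoints) (hfin : (S : Set W.geomPoints).Finite)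
    (hstab : ∀ (σ : Field.absoluteGaloisGroup ℚ) (P : W.geomPoints), P ∈ S → σ • P ∈ S)
    (hcyc : IsAddCyclic S) {k : ℕ} (hk : 2 ^ k ∣ Nat.card S) : k ≤ 4 := by
  by_contra hlt
  have h32 : 32 ∣ Nat.card S := by
    refine dvd_trans ?_ hk
    rw [show (32 : ℕ) = 2 ^ 5 by norm_num]
    exact pow_dvd_pow 2 (by omega)
  exact absurd (mem_kenkuDegrees_of_dvd_natCard_of_stable_of_isAddCyclic_of_mazurKenku h W S hfin
    hstab hcyc h32) (by decide)

end Literature.NumberTheory.EllipticCurves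

end
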